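import Literature.Barriers.QuantumAdvantage.NoiseThresholdUpperBoundsBridge
import Mathlib.Analysis.SpecialFunctions.Log.Base
import HarnessLib

/-!
# Kempe–Regev–Unger–de Wolf 2008, Theorem 1 — proof

Discharge of the named fact `Literature.Barriers.QuantumAdvantage.kempeRegevUngerDeWolf2008_thm1`
(J. Kempe, O. Regev, F. Unger, R. de Wolf, *Upper bounds on the noise threshold for
fault-tolerant quantum computing*, Quantum Inf. Comput. 10 (2010) 361–376, Theorem 1
[KempeEtAl2010]) over the circuit model of `NoiseThresholdUpperBounds.lean`, following §3 of the
paper (proof of Lemma 7 by induction over the circuit, then Observation 5):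

* the two induction steps for the model's gates (`pauliWeight_qubitGate_le`,
  `pauliWeight_mixedUnitaryGate_le`: §3.1.2 Cases 2 and 1, the latter with Observation 6);
* the invariant of Lemma 7 in sequential form: writing `F(σ, W) = Σ_{S ∈ 𝒫^W} |Tr(S σ)|²`
  (`pauliWeight`), after `t` complete levels and with the wires already processed in the current
  level marked by a predicate `C`, the state `σ` (the image of `δ = ρ − τ`) satisfies
  `F(σ, ∅) = 0`, `F(σ, W) ≤ 2 · 2^{|W|} θ^t` for every nonempty `W`, and
  `F(σ, W) ≤ 2 · 2^{|W|} θ^{t+1}` if moreover `W ⊆ C` — i.e. `θ^{dist(V)}` with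
  `dist ∈ {t, t+1}` (`inv_gate_step`, `inv_foldl_gates`, `inv_level`, `inv_foldl_levels`);
  the base case is `pauliWeight_sub_le_of_density` (§3.1.1);
* the constant: `θ = max((1 + ν₁²)/2, (1 + ν_k²)^k/2)` with `ν₁ = max(0, 1 − ε₁)`,
  `ν_k = max(0, 1 − ε_k)`; `θ < 1` exactly because `ε₁ > 0` and `ε_k > 1 − √(2^{1/k} − 1)`
  (`theta_lt_one`);
* the output step (Observation 5): `p₁(ρ) − p₁(τ) = −½ Tr(Z_out · C(δ))` since `Tr C(δ) = 0`,
  hence `|p₁(ρ) − p₁(τ)| ≤ ½ √(F(C(δ), {out})) ≤ θ^{T/2} = 2^{−cT}` with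
  `c = −½ log₂ θ > 0` and `T₀ = 0`.

The auxiliary Lemma 8 is proved in `QubitChannelLemma8.lean` by a pointwise bound and Yuan's
lemma rather than by the Ruskai–Szarek–Werner normal form used in print; everything else follows
the printed argument (Observations 2–6, Lemma 7, Cases 1–2).

## References

* [KempeEtAl2010] J. Kempe, O. Regev, F. Unger, R. de Wolf, Quantum Inf. Comput. 10 (2010)
  361–376; arXiv:0802.1464, Theorem 1, §3 (Lemma 7, Lemma 8), Observation 5.
-/

noncomputable section

open Matrix Finset Literature.Computability.Cryptography Literature.Computability.QuantumComplexity

namespace Literature.Barriers.QuantumAdvantage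

variable {n k : ℕ}

/-! ### The two induction steps of Lemma 7 for the model's gates -/

/-- **Case 2 for the model**: a one-qubit gate followed by `p`-noise, `j ∈ W`.
[cite: KempeEtAl2010, §3.1.2 Case 2] -/
theorem pauliWeight_qubitGate_le (j : Fin n) (G : QubitChannel) {p : ℝ} (hp0 : 0 ≤ p) (hp1 : p ≤ 1)
    (M : MixedState n) {W : Finset (Fin n)} (hj : j ∈ W) {c : ℝ}
    (hM : ∀ W' : Finset (Fin n), pauliWeight M W' ≤ c * 2 ^ W'.card) :
    pauliWeight ((NoisyGate.qubit j G p : NoisyGate n k).apply M) W ≤ (1 + (1 - p) ^ 2) / 2 * c * 2 ^ W.card := by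
  rw [NoisyGate.apply, depolarizeWire_eq, QubitChannel.apply_eq]
  exact pauliWeight_noisyQubitGate_le _ (QubitChannel.sum_kraus_bool G) hp0 hp1 M hj hM

/-- **Case 1 for the model**: `p`-noise on the block then a mixture of unitaries on it, the block
meeting `W` (Observation 6 reduces to one unitary). [cite: KempeEtAl2010, §3.1.2 Case 1] -/
theorem pauliWeight_mixedUnitaryGate_le (e : Fin k ↪ Fin n) (G : MixedUnitaryGate k) {p : ℝ} (hp0 : 0 ≤ p)
    (hp1 : p ≤ 1) (M : MixedState n) {W : Finset (Fin n)} (hW : (W ∩ Finset.univ.map e).Nonempty) {c : ℝ}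
    (hM : ∀ W' : Finset (Fin n), pauliWeight M W' ≤ c * 2 ^ W'.card) :
    pauliWeight ((NoisyGate.mixedUnitary e G p : NoisyGate n k).apply M) W ≤
      (1 + (1 - p) ^ 2) ^ k / 2 * c * 2 ^ W.card := by
  rw [NoisyGate.apply, MixedUnitaryGate.apply_eq, depolarizeWires_eq_foldl]
  refine (pauliWeight_sum_smul_le Finset.univ G.weight (fun i _ => G.weight_nonneg i) G.sum_weight _ W).trans ?_
  have hL : ((List.finRange k).map e).Nodup := (List.nodup_finRange k).map e.injective
  have hLA : ((List.finRange k).map e).toFinset = Finset.univ.map e := by ext i; simp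
  have hbound : ∀ i, pauliWeight (placeGate e (G.unitary i) *
      ((List.finRange k).map e).foldl (fun N j => (1 - (p : ℂ)) • N + (p : ℂ) • ((1 / 4 : ℂ) • ∑ Q,
        pauliString (Function.update (fun _ : Fin n => Pauli.I) j Q) * N *
          pauliString (Function.update (fun _ : Fin n => Pauli.I) j Q))) M * (placeGate e (G.unitary i))ᴴ) W ≤
      (1 + (1 - p) ^ 2) ^ k / 2 * c * 2 ^ W.card := by
    intro i
    have h := pauliWeight_noisyUnitary_le hL hLA (placeGate e (G.unitary i)) (G.conjTranspose_mul_self e i)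
      (fun j hj Q => pauliString_single_mul_placeGate e (by simpa using hj) Q (G.unitary i)) hp0 hp1 M hW hM
    rwa [Finset.card_map, Finset.card_univ, Fintype.card_fin] at h
  calc ∑ i, G.weight i * pauliWeight (placeGate e (G.unitary i) * _ * (placeGate e (G.unitary i))ᴴ) W
      ≤ ∑ i, G.weight i * ((1 + (1 - p) ^ 2) ^ k / 2 * c * 2 ^ W.card) :=
        Finset.sum_le_sum fun i _ => mul_le_mul_of_nonneg_left (hbound i) (G.weight_nonneg i)
    _ = (1 + (1 - p) ^ 2) ^ k / 2 * c * 2 ^ W.card := by rw [← Finset.sum_mul, G.sum_weight, one_mul]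

/-! ### The invariant of Lemma 7 through one gate, one level, the circuit -/

/-- **Induction step of Lemma 7 for one noisy gate.** The invariant "`F(σ, ∅) = 0`,
`F(σ, W) ≤ 2·2^{|W|}θ^t` for nonempty `W`, and `≤ 2·2^{|W|}θ^{t+1}` when all wires of `W` are
already processed (`C`)" is preserved by a gate `g` of the level, with the wires of `g` added to
the processed ones. Here `θ ≥ (1 + ν₁²)/2` and `θ ≥ (1 + ν_k²)^k/2`, `ν = max(0, 1 − ε)`.
[cite: KempeEtAl2010, §3.1.2 (Cases 1 and 2; dist(V'') − 1 ≤ dist(V))] -/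
theorem inv_gate_step {ε₁ εk θ : ℝ} (hε₁ : 0 < ε₁) (hεk : 0 ≤ εk) (hθ1 : θ ≤ 1)
    (hθq : (1 + (max 0 (1 - ε₁)) ^ 2) / 2 ≤ θ) (hθm : (1 + (max 0 (1 - εk)) ^ 2) ^ k / 2 ≤ θ)
    (g : NoisyGate n k) (hg : g.RateAtLeast ε₁ εk) {t : ℕ} {C : Fin n → Prop} {σ : MixedState n}
    (h0 : pauliWeight σ ∅ = 0)
    (h1 : ∀ W : Finset (Fin n), W.Nonempty → pauliWeight σ W ≤ 2 * 2 ^ W.card * θ ^ t)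
    (h2 : ∀ W : Finset (Fin n), W.Nonempty → (∀ j ∈ W, C j) → pauliWeight σ W ≤ 2 * 2 ^ W.card * θ ^ (t + 1)) :
    pauliWeight (g.apply σ) ∅ = 0 ∧
    (∀ W : Finset (Fin n), W.Nonempty → pauliWeight (g.apply σ) W ≤ 2 * 2 ^ W.card * θ ^ t) ∧
    (∀ W : Finset (Fin n), W.Nonempty → (∀ j ∈ W, C j ∨ j ∈ g.wires) →
      pauliWeight (g.apply σ) W ≤ 2 * 2 ^ W.card * θ ^ (t + 1)) := by
  have hθ0 : 0 ≤ θ := le_trans (by positivity) hθq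
  have hpow : θ ^ (t + 1) ≤ θ ^ t := pow_le_pow_of_le_one hθ0 hθ1 (Nat.le_succ t)
  -- the hypothesis of the gate lemmas with `c = 2 θ^t`
  have hM : ∀ W' : Finset (Fin n), pauliWeight σ W' ≤ 2 * θ ^ t * 2 ^ W'.card := by
    intro W'
    rcases W'.eq_empty_or_nonempty with rfl | hW'
    · rw [h0]; positivity
    · calc pauliWeight σ W' ≤ 2 * 2 ^ W'.card * θ ^ t := h1 W' hW'
        _ = 2 * θ ^ t * 2 ^ W'.card := by ring
  -- the gate bound when `W` meets the block
  have hmeet : ∀ W : Finset (Fin n), (W ∩ g.wires).Nonempty →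
      pauliWeight (g.apply σ) W ≤ 2 * 2 ^ W.card * θ ^ (t + 1) := by
    intro W hW
    have key : pauliWeight (g.apply σ) W ≤ θ * (2 * θ ^ t) * 2 ^ W.card := by
      cases g with
      | qubit j G p =>
        obtain ⟨hp1, hp2⟩ : ε₁ ≤ p ∧ p ≤ 1 := hg
        have hj : j ∈ W := by
          obtain ⟨i, hi⟩ := hW
          simp only [NoisyGate.wires, Finset.mem_inter, Finset.mem_singleton] at hi
          exact hi.2 ▸ hi.1
        refine (pauliWeight_qubitGate_le j G (by linarith) hp2 σ hj hM).trans ?_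
        have hfac : (1 + (1 - p) ^ 2) / 2 ≤ θ := by
          refine le_trans ?_ hθq
          have : (1 - p) ^ 2 ≤ (max 0 (1 - ε₁)) ^ 2 :=
            pow_le_pow_left₀ (by linarith) (le_max_of_le_right (by linarith)) 2
          linarith
        have : 0 ≤ 2 * θ ^ t * 2 ^ W.card := by positivity
        nlinarith
      | mixedUnitary e G p =>
        obtain ⟨hp1, hp2⟩ : εk ≤ p ∧ p ≤ 1 := hg
        refine (pauliWeight_mixedUnitaryGate_le e G (by linarith) hp2 σ hW hM).trans ?_
        have hfac : (1 + (1 - p) ^ 2) ^ k / 2 ≤ θ := by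
          refine le_trans ?_ hθm
          have : (1 - p) ^ 2 ≤ (max 0 (1 - εk)) ^ 2 :=
            pow_le_pow_left₀ (by linarith) (le_max_of_le_right (by linarith)) 2
          have : (1 + (1 - p) ^ 2) ^ k ≤ (1 + (max 0 (1 - εk)) ^ 2) ^ k :=
            pow_le_pow_left₀ (by positivity) (by linarith) k
          linarith
        have : 0 ≤ 2 * θ ^ t * 2 ^ W.card := by positivity
        nlinarith
    calc pauliWeight (g.apply σ) W ≤ θ * (2 * θ ^ t) * 2 ^ W.card := key
      _ = 2 * 2 ^ W.card * θ ^ (t + 1) := by ring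
  -- the invariance when `W` misses the block
  have hmiss : ∀ W : Finset (Fin n), ¬ (W ∩ g.wires).Nonempty → pauliWeight (g.apply σ) W = pauliWeight σ W := by
    intro W hW
    refine g.pauliWeight_apply_of_disjoint ?_ σ
    rw [Finset.not_nonempty_iff_eq_empty] at hW
    exact Finset.disjoint_iff_inter_eq_empty.2 hW
  refine ⟨?_, ?_, ?_⟩
  · rw [hmiss ∅ (by simp), h0]
  · intro W hW
    by_cases hWg : (W ∩ g.wires).Nonempty
    · exact (hmeet W hWg).trans (by gcongr)
    · rw [hmiss W hWg]; exact h1 W hW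
  · intro W hW hC
    by_cases hWg : (W ∩ g.wires).Nonempty
    · exact hmeet W hWg
    · rw [hmiss W hWg]
      refine h2 W hW fun j hj => (hC j hj).resolve_right fun hjg => hWg ⟨j, Finset.mem_inter.2 ⟨hj, hjg⟩⟩

/-- The invariant through a list of gates (generalising the processed predicate).
[cite: KempeEtAl2010, §3.1 (ordering of the consistent sets)] -/
theorem inv_foldl_gates {ε₁ εk θ : ℝ} (hε₁ : 0 < ε₁) (hεk : 0 ≤ εk) (hθ1 : θ ≤ 1)
    (hθq : (1 + (max 0 (1 - ε₁)) ^ 2) / 2 ≤ θ) (hθm : (1 + (max 0 (1 - εk)) ^ 2) ^ k / 2 ≤ θ)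
    (gs : List (NoisyGate n k)) (hgs : ∀ g ∈ gs, g.RateAtLeast ε₁ εk) {t : ℕ} {C : Fin n → Prop}
    {σ : MixedState n} (h0 : pauliWeight σ ∅ = 0)
    (h1 : ∀ W : Finset (Fin n), W.Nonempty → pauliWeight σ W ≤ 2 * 2 ^ W.card * θ ^ t)
    (h2 : ∀ W : Finset (Fin n), W.Nonempty → (∀ j ∈ W, C j) → pauliWeight σ W ≤ 2 * 2 ^ W.card * θ ^ (t + 1)) :
    pauliWeight (gs.foldl (fun τ g => g.apply τ) σ) ∅ = 0 ∧
    (∀ W : Finset (Fin n), W.Nonempty → pauliWeight (gs.foldl (fun τ g => g.apply τ) σ) W ≤ 2 * 2 ^ W.card * θ ^ t) ∧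
    (∀ W : Finset (Fin n), W.Nonempty → (∀ j ∈ W, C j ∨ ∃ g ∈ gs, j ∈ g.wires) →
      pauliWeight (gs.foldl (fun τ g => g.apply τ) σ) W ≤ 2 * 2 ^ W.card * θ ^ (t + 1)) := by
  induction gs generalizing C σ with
  | nil =>
    refine ⟨h0, h1, fun W hW hC => h2 W hW fun j hj => ?_⟩
    rcases hC j hj with h | ⟨g, hg, -⟩
    · exact h
    · simp at hg
  | cons g gs ih =>
    obtain ⟨h0', h1', h2'⟩ := inv_gate_step hε₁ hεk hθ1 hθq hθm g (hgs g List.mem_cons_self) h0 h1 h2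
    obtain ⟨h0'', h1'', h2''⟩ := ih (fun g' hg' => hgs g' (List.mem_cons_of_mem g hg')) h0' h1' h2'
    rw [List.foldl_cons]
    refine ⟨h0'', h1'', fun W hW hC => h2'' W hW fun j hj => ?_⟩
    rcases hC j hj with h | ⟨g', hg', hjg'⟩
    · exact Or.inl (Or.inl h)
    · rcases List.mem_cons.1 hg' with rfl | hg''
      · exact Or.inl (Or.inr hjg')
      · exact Or.inr ⟨g', hg'', hjg'⟩

/-- **One complete level raises the distance**: since every wire goes through some gate of the
level, after the level the invariant holds with `t + 1`. [cite: KempeEtAl2010, §1 (all qubits go through some gate) and §3] -/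
theorem inv_level {ε₁ εk θ : ℝ} (hε₁ : 0 < ε₁) (hεk : 0 ≤ εk) (hθ1 : θ ≤ 1)
    (hθq : (1 + (max 0 (1 - ε₁)) ^ 2) / 2 ≤ θ) (hθm : (1 + (max 0 (1 - εk)) ^ 2) ^ k / 2 ≤ θ)
    (L : NoisyLevel n k) (hL : ∀ g ∈ L.gates, g.RateAtLeast ε₁ εk) {t : ℕ} {σ : MixedState n}
    (h0 : pauliWeight σ ∅ = 0)
    (h1 : ∀ W : Finset (Fin n), W.Nonempty → pauliWeight σ W ≤ 2 * 2 ^ W.card * θ ^ t) :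
    pauliWeight (L.apply σ) ∅ = 0 ∧
    (∀ W : Finset (Fin n), W.Nonempty → pauliWeight (L.apply σ) W ≤ 2 * 2 ^ W.card * θ ^ (t + 1)) := by
  obtain ⟨h0', -, h2'⟩ := inv_foldl_gates hε₁ hεk hθ1 hθq hθm L.gates hL (C := fun _ => False) h0 h1
    (fun W hW hC => by obtain ⟨j, hj⟩ := hW; exact absurd (hC j hj) id)
  refine ⟨h0', fun W hW => h2' W hW fun j _ => Or.inr ?_⟩
  obtain ⟨g, hg, hjg⟩ := L.cover j
  exact ⟨g, hg, hjg⟩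

/-- **Lemma 7 along the circuit**: after the levels `Ls` the invariant holds with the distance
raised by `Ls.length`. [cite: KempeEtAl2010, Lemma 7] -/
theorem inv_foldl_levels {ε₁ εk θ : ℝ} (hε₁ : 0 < ε₁) (hεk : 0 ≤ εk) (hθ1 : θ ≤ 1)
    (hθq : (1 + (max 0 (1 - ε₁)) ^ 2) / 2 ≤ θ) (hθm : (1 + (max 0 (1 - εk)) ^ 2) ^ k / 2 ≤ θ)
    (Ls : List (NoisyLevel n k)) (hLs : ∀ L ∈ Ls, ∀ g ∈ L.gates, g.RateAtLeast ε₁ εk) {t : ℕ}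
    {σ : MixedState n} (h0 : pauliWeight σ ∅ = 0)
    (h1 : ∀ W : Finset (Fin n), W.Nonempty → pauliWeight σ W ≤ 2 * 2 ^ W.card * θ ^ t) :
    pauliWeight (Ls.foldl (fun τ L => L.apply τ) σ) ∅ = 0 ∧
    (∀ W : Finset (Fin n), W.Nonempty →
      pauliWeight (Ls.foldl (fun τ L => L.apply τ) σ) W ≤ 2 * 2 ^ W.card * θ ^ (t + Ls.length)) := by
  induction Ls generalizing t σ with
  | nil => exact ⟨h0, by simpa using h1⟩
  | cons L Ls ih =>
    obtain ⟨h0', h1'⟩ := inv_level hε₁ hεk hθ1 hθq hθm L (hLs L List.mem_cons_self) h0 h1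
    obtain ⟨h0'', h1''⟩ := ih (fun L' hL' => hLs L' (List.mem_cons_of_mem L hL')) h0' h1'
    refine ⟨h0'', fun W hW => ?_⟩
    have := h1'' W hW
    rwa [List.length_cons, show t + (Ls.length + 1) = t + 1 + Ls.length by ring]

/-! ### Linearity of the circuit and the output qubit -/

/-- A level is subtractive. [cite: KempeEtAl2010, §3 (linearity)] -/
theorem NoisyLevel.apply_sub (L : NoisyLevel n k) (M N : MixedState n) : L.apply (M - N) = L.apply M - L.apply N := by
  unfold NoisyLevel.apply
  induction L.gates generalizing M N with
  | nil => rfl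
  | cons g gs ih => rw [List.foldl_cons, List.foldl_cons, List.foldl_cons, NoisyGate.apply_sub, ih]

/-- The circuit is subtractive: `C(ρ) − C(τ) = C(ρ − τ)`. [cite: KempeEtAl2010, §3 (linearity)] -/
theorem NoisyCircuit.run_sub (C : NoisyCircuit n k) (M N : MixedState n) : C.run (M - N) = C.run M - C.run N := by
  unfold NoisyCircuit.run
  induction C.levels generalizing M N with
  | nil => rfl
  | cons L Ls ih => rw [List.foldl_cons, List.foldl_cons, List.foldl_cons, NoisyLevel.apply_sub, ih]

/-- **Observation 5 in the register**: the probability of outcome `1` on the output qubit is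
`½ (Tr N − Tr(Z_out N))`. [cite: KempeEtAl2010, Observation 5] -/
theorem sum_filter_out_eq (out : Fin n) (N : MixedState n) :
    ∑ x ∈ Finset.univ.filter (fun x : QReg n => x out = true), N x x =
      (N.trace - pauliCoeff N (Function.update (fun _ : Fin n => Pauli.I) out Pauli.Z)) / 2 := by
  -- the string `Z_out` is diagonal with entries `∓1`
  have hdiag : ∀ x y : QReg n, pauliString (Function.update (fun _ : Fin n => Pauli.I) out Pauli.Z) x y =
      if x = y then (if x out = true then -1 else 1) else 0 := by
    intro x y
    rw [pauliString_update_const, tensorAll_update_apply, Pauli.mat_Z_apply]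
    have hprod : (∏ i ∈ Finset.univ.erase out, (1 : Matrix Bool Bool ℂ) (x i) (y i)) =
        if ∀ i, i ≠ out → x i = y i then 1 else 0 := by
      simp only [Matrix.one_apply]
      rw [Finset.prod_boole]
      simp
    rw [hprod]
    by_cases hxy : x = y
    · subst hxy; simp
    · rw [if_neg hxy]
      by_cases hout : x out = y out
      · rw [if_neg (show ¬ (∀ i, i ≠ out → x i = y i) from fun h =>
          hxy (funext fun i => if hi : i = out then hi ▸ hout else h i hi)), mul_zero]
      · rw [if_neg hout, zero_mul]
  have hcoeff : pauliCoeff N (Function.update (fun _ : Fin n => Pauli.I) out Pauli.Z) =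
      ∑ x : QReg n, (if x out = true then -1 else 1) * N x x := by
    rw [pauliCoeff_eq, Matrix.trace]
    refine Finset.sum_congr rfl fun x _ => ?_
    rw [Matrix.diag_apply, Matrix.mul_apply, Finset.sum_eq_single x]
    · rw [hdiag, if_pos rfl]
    · intro y _ hy; rw [hdiag, if_neg (Ne.symm hy), zero_mul]
    · exact fun h => absurd (Finset.mem_univ _) h
  rw [hcoeff, Matrix.trace, ← Finset.sum_filter_add_sum_filter_not Finset.univ (fun x : QReg n => x out = true),
    ← Finset.sum_filter_add_sum_filter_not Finset.univ (fun x : QReg n => x out = true)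
      (fun x => (if x out = true then -1 else 1) * N x x)]
  simp only [Matrix.diag_apply]
  have hA : ∑ x ∈ Finset.univ.filter (fun x : QReg n => x out = true), (if x out = true then -1 else 1) * N x x =
      ∑ x ∈ Finset.univ.filter (fun x : QReg n => x out = true), -N x x :=
    Finset.sum_congr rfl fun x hx => by rw [if_pos (Finset.mem_filter.1 hx).2]; ring
  have hB : ∑ x ∈ Finset.univ.filter (fun x : QReg n => ¬ x out = true), (if x out = true then -1 else 1) * N x x =
      ∑ x ∈ Finset.univ.filter (fun x : QReg n => ¬ x out = true), N x x :=
    Finset.sum_congr rfl fun x hx => by rw [if_neg (Finset.mem_filter.1 hx).2]; ring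
  rw [hA, hB, Finset.sum_neg_distrib]
  ring

/-! ### The constant `θ` -/

/-- `θ = max((1 + ν₁²)/2, (1 + ν_k²)^k/2)` with `ν = max(0, 1 − ε)` lies in `[1/2, 1)` when
`ε₁ > 0` and `ε_k > 1 − √(2^{1/k} − 1)` (`k ≥ 1`): "`(1 + μ²)^k ≤ 2θ` if `θ` is close enough to
`1`" and "`1 + (1 − ε₁)² ≤ 2θ`". [cite: KempeEtAl2010, §3.1.2 (end of Case 1, end of Case 2)] -/
theorem theta_lt_one {k : ℕ} {ε₁ εk : ℝ} (hk : 1 ≤ k) (hε₁ : 0 < ε₁) (hεk : kruwThreshold k < εk) :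
    max ((1 + (max 0 (1 - ε₁)) ^ 2) / 2) ((1 + (max 0 (1 - εk)) ^ 2) ^ k / 2) < 1 := by
  refine max_lt ?_ ?_
  · have h1 : max 0 (1 - ε₁) < 1 := max_lt one_pos (by linarith)
    have h0 : 0 ≤ max 0 (1 - ε₁) := le_max_left _ _
    nlinarith
  · -- `(1 + ν_k²)^k < 2`
    have hk0 : (k : ℝ) ≠ 0 := by exact_mod_cast (by omega : k ≠ 0)
    have htwo : ((2 : ℝ) ^ (1 / (k : ℝ))) ^ k = 2 := by
      rw [← Real.rpow_natCast, ← Real.rpow_mul (by norm_num)]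
      field_simp
      exact Real.rpow_one 2
    have hbase : 0 < (2 : ℝ) ^ (1 / (k : ℝ)) - 1 := by
      have : (1 : ℝ) < (2 : ℝ) ^ (1 / (k : ℝ)) := Real.one_lt_rpow (by norm_num) (by positivity)
      linarith
    have hlt : 1 + (max 0 (1 - εk)) ^ 2 < (2 : ℝ) ^ (1 / (k : ℝ)) := by
      rcases le_or_gt εk 1 with hle | hgt
      · have hm : max 0 (1 - εk) = 1 - εk := max_eq_right (by linarith)
        rw [hm]
        have h := hεk
        rw [kruwThreshold] at h
        have h' : 1 - εk < Real.sqrt ((2 : ℝ) ^ (1 / (k : ℝ)) - 1) := by linarith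
        have h'' := (Real.lt_sqrt (by linarith)).1 h'
        linarith
      · have hm : max 0 (1 - εk) = 0 := max_eq_left (by linarith)
        rw [hm]
        have : (1 : ℝ) < (2 : ℝ) ^ (1 / (k : ℝ)) := Real.one_lt_rpow (by norm_num) (by positivity)
        simpa using this
    have hpow : (1 + (max 0 (1 - εk)) ^ 2) ^ k < ((2 : ℝ) ^ (1 / (k : ℝ))) ^ k :=
      pow_lt_pow_left₀ hlt (by positivity) (by omega)
    rw [htwo] at hpow
    linarith

/-! ### Theorem 1 -/

/-- **Discharge of `kempeRegevUngerDeWolf2008_thm1`** (Kempe–Regev–Unger–de Wolf, Quantum Inf.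
Comput. 10 (2010) 361–376, Theorem 1: "Fix any `T`-level quantum circuit as above. Then for any
two states `ρ` and `τ`, the probabilities of obtaining measurement outcome `1` at the output
qubit starting from `ρ` and starting from `τ`, respectively, differ by at most `2^{−Ω(T)}`"),
with `c = −½ log₂ θ`, `T₀ = 0`: by Lemma 7 (`inv_foldl_levels` from the base case
`pauliWeight_sub_le_of_density`) the difference `δ = C(ρ) − C(τ)` has `Tr δ = 0` and
`|Tr(Z_out δ)|² ≤ F(δ, {out}) ≤ 4 θ^T`, and by Observation 5 `p₁(ρ) − p₁(τ) = −½ Tr(Z_out δ)`.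
[cite: KempeEtAl2010, Theorem 1 (proof, §3)] -/
theorem kempeRegevUngerDeWolf2008_thm1_holds : kempeRegevUngerDeWolf2008_thm1 := by
  intro k ε₁ εk hk hε₁ hεk
  set θ : ℝ := max ((1 + (max 0 (1 - ε₁)) ^ 2) / 2) ((1 + (max 0 (1 - εk)) ^ 2) ^ k / 2) with hθ
  have hθ1 : θ < 1 := theta_lt_one hk hε₁ hεk
  have hθpos : 0 < θ := lt_of_lt_of_le (by positivity) (le_max_left _ _)
  have hθq : (1 + (max 0 (1 - ε₁)) ^ 2) / 2 ≤ θ := le_max_left _ _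
  have hθm : (1 + (max 0 (1 - εk)) ^ 2) ^ k / 2 ≤ θ := le_max_right _ _
  have hεk0 : 0 ≤ εk := by
    have : 0 ≤ kruwThreshold k := by
      rw [kruwThreshold, sub_nonneg, Real.sqrt_le_one]
      have h1 : (2 : ℝ) ^ (1 / (k : ℝ)) ≤ 2 ^ (1 : ℝ) := by
        refine Real.rpow_le_rpow_of_exponent_le (by norm_num) ?_
        rw [div_le_one (by exact_mod_cast (by omega : 0 < k))]
        exact_mod_cast hk
      rw [Real.rpow_one] at h1
      linarith
    linarith
  have hlog : Real.logb 2 θ < 0 := Real.logb_neg (by norm_num) hθpos hθ1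
  refine ⟨-(Real.logb 2 θ) / 2, by linarith, 0, fun n C hC _ ρ τ hρ hτ => ?_⟩
  -- Lemma 7 for `δ = ρ − τ`
  set δ : MixedState n := ρ - τ with hδ
  have hbase0 : pauliWeight δ ∅ = 0 := by
    rw [pauliWeight_empty, hδ, trace_sub, hρ.2, hτ.2, sub_self, norm_zero]; ring
  have hbase1 : ∀ W : Finset (Fin n), W.Nonempty → pauliWeight δ W ≤ 2 * 2 ^ W.card * θ ^ 0 := by
    intro W _
    rw [pow_zero, mul_one]
    exact pauliWeight_sub_le_of_density hρ.1 hρ.2 hτ.1 hτ.2 W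
  obtain ⟨hT0, hT1⟩ := inv_foldl_levels hε₁ hεk0 hθ1.le hθq hθm C.levels hC hbase0 hbase1
  rw [zero_add] at hT1
  change pauliWeight (C.run δ) ∅ = 0 at hT0
  change ∀ W : Finset (Fin n), W.Nonempty → pauliWeight (C.run δ) W ≤ 2 * 2 ^ W.card * θ ^ C.depth at hT1
  -- trace zero and the output coefficient
  have htr : (C.run δ).trace = 0 := by
    have h := hT0
    rw [pauliWeight_empty, sq_eq_zero_iff, norm_eq_zero] at h
    exact h
  have hout : ‖pauliCoeff (C.run δ) (Function.update (fun _ : Fin n => Pauli.I) C.out Pauli.Z)‖ ^ 2 ≤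
      4 * θ ^ C.depth := by
    refine (norm_pauliCoeff_sq_le_pauliWeight (C.run δ) (W := {C.out}) ?_).trans ?_
    · refine mem_stringsOn.2 fun i hi => ?_
      rw [Function.update_of_ne]
      exact fun h => hi (by simp [h])
    · have := hT1 {C.out} (Finset.singleton_nonempty _)
      simp only [Finset.card_singleton, pow_one] at this
      linarith
  -- Observation 5
  have hdiff : C.probOne ρ - C.probOne τ =
      (-(pauliCoeff (C.run δ) (Function.update (fun _ : Fin n => Pauli.I) C.out Pauli.Z)) / 2).re := by
    rw [NoisyCircuit.probOne, NoisyCircuit.probOne, ← Complex.sub_re, ← Finset.sum_sub_distrib]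
    have : ∑ x ∈ Finset.univ.filter (fun x : QReg n => x C.out = true), (C.run ρ x x - C.run τ x x) =
        ∑ x ∈ Finset.univ.filter (fun x : QReg n => x C.out = true), C.run δ x x := by
      refine Finset.sum_congr rfl fun x _ => ?_
      rw [hδ, NoisyCircuit.run_sub, Matrix.sub_apply]
    rw [this, sum_filter_out_eq, htr, zero_sub]
  -- the final estimate
  have hnorm : |C.probOne ρ - C.probOne τ| ≤ Real.sqrt (θ ^ C.depth) := by
    rw [hdiff]
    refine (Complex.abs_re_le_norm _).trans ?_
    rw [norm_div, norm_neg, Complex.norm_two]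
    have h2 : ‖pauliCoeff (C.run δ) (Function.update (fun _ : Fin n => Pauli.I) C.out Pauli.Z)‖ ≤
        2 * Real.sqrt (θ ^ C.depth) := by
      have h4 : Real.sqrt 4 = 2 := by
        rw [show (4 : ℝ) = 2 ^ 2 by norm_num, Real.sqrt_sq (by norm_num)]
      rw [← Real.sqrt_sq (norm_nonneg _), ← h4, ← Real.sqrt_mul (by norm_num)]
      exact Real.sqrt_le_sqrt hout
    linarith
  refine hnorm.trans (le_of_eq ?_)
  -- `√(θ^T) = 2^{-(c T)}` with `c = -log₂ θ / 2`
  rw [Real.sqrt_eq_rpow, ← Real.rpow_natCast, ← Real.rpow_mul hθpos.le,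
    show -(-Real.logb 2 θ / 2 * (C.depth : ℝ)) = Real.logb 2 θ * ((C.depth : ℝ) * (1 / 2)) by ring,
    Real.rpow_mul (by norm_num : (0 : ℝ) ≤ 2), Real.rpow_logb (by norm_num) (by norm_num) hθpos]

/-- **Discharge of the catalogue barrier `NoiseThresholdUpperBounds`** (D-0021 entry of
`NoiseThresholdUpperBounds.lean`), which is definitionally Kempe–Regev–Unger–de Wolf's Theorem 1
(`noiseThresholdUpperBounds_iff`): it holds by `kempeRegevUngerDeWolf2008_thm1_holds` above. With
it the proved decision-gap reading `NoiseThresholdUpperBounds.eventually_no_gap` becomes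
unconditional. [cite: KempeEtAl2010, Thm 1] -/
theorem NoiseThresholdUpperBounds_holds : NoiseThresholdUpperBounds :=
  kempeRegevUngerDeWolf2008_thm1_holds

/-- The decision-gap reading of the barrier, now unconditional: beyond a depth `T₁(k, ε₁, ε_k)`
no circuit of the model accepts one input state with probability `≥ 2/3` and another with
probability `≤ 1/3`. [cite: KempeEtAl2010, Thm 1 and §1 ("making the circuit useless")] -/
theorem eventually_no_gap {k : ℕ} {ε₁ εk : ℝ} (hk : 1 ≤ k) (hε₁ : 0 < ε₁)
    (hεk : kruwThreshold k < εk) :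
    ∃ T₁ : ℕ, ∀ (n : ℕ) (C : NoisyCircuit n k), C.RatesAtLeast ε₁ εk → T₁ ≤ C.depth →
      ∀ ρ τ : MixedState n, IsDensity ρ → IsDensity τ →
        ¬ (2 / 3 ≤ C.probOne ρ ∧ C.probOne τ ≤ 1 / 3) :=
  NoiseThresholdUpperBounds_holds.eventually_no_gap hk hε₁ hεk

end Literature.Barriers.QuantumAdvantage
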